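import Literature.Barriers.ValiantsHypothesis.MonotoneGapPermanentLower
import Literature.Barriers.ValiantsHypothesis.MonotoneGapHamiltonianWeights
import Literature.Barriers.ValiantsHypothesis.MonotoneGapHamiltonianCycles
import HarnessLib

/-!
# Jerrum–Snir's lower bound for the monotone complexity of the Hamiltonian circuit polynomial
(J. ACM 29 (1982), §4.4)

The combinatorial half of §4.4 (pp. 889–890) of

* [JerrumSnir1982] M. Jerrum, M. Snir, *Some exact complexity results for straight-line
  computations over semirings*, J. ACM 29 (1982) 874–897,

for the tree's Hamiltonian cycle polynomial `hcPoly (Fin n) R = Σ_{π : cycleType π = {n}} Π_i X_{π i, i}`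
(`Literature.Computability.AlgebraicComplexity.hcPoly`; the arc `i → π i` of the Hamiltonian
circuit `π` is the variable `(π i, i)`), companion of `MonotoneGapPermanentLower.lean` (§4.3):

* the monomial set: `hcPoly_eq_sum_monomial`, `mem_support_hcPoly` (`m ∈ mon(HC) ↔ m = μ_π` for a
  full cycle `π`, with `μ_π = permMonomial π` of `PermanentIrreducible.lean`), `card_support_hcPoly`
  (`|mon(HC_{n×n})| = (n-1)!`, Mathlib's `Equiv.Perm.card_of_cycleType_singleton`);
* `JerrumSnir.card_le_factorial_pred_of_add_mem` — one block of JS's partition argument: if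
  `a + e ∈ mon(HC)` for all `a ∈ A` then all `a ∈ A` occupy the same `d = deg a₀` columns `I_a`,
  the cycles `π_{a+e}` pairwise agree off `I_a` (they are `e` there), hence
  `|A| ≤ (d - 1)!` by the extension count `card_le_factorial_of_agree` of
  `MonotoneGapHamiltonianCycles.lean` (JS p. 890: `π ↦ π*`, "`|mon(a)| ≤ (d-1)!`");
* `JerrumSnir.card_mul_card_mul_card_le_hc` — **the content bound for `HC`** in the three-set form
  of `JerrumSnir.ContentBound` (`MonotoneGapParseTrees.lean`): `A + B + C ⊆ mon(HC)` implies
  `|A|·|B|·|C| ≤ (deg a - 1)! (deg b - 1)! (n - deg a - deg b - 1)!` (the last factor being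
  `(0-1)! = 1` in the degenerate case `deg a + deg b = n`, JS's "`|mon(c)| ≤ (n-r-1)!` (`r < n`),
  `1` (`r = n`)");
* `JerrumSnir.contentBound_hcPoly`, `JerrumSnir.weightBound_hc` — the hypotheses of the general
  lower bound `JerrumSnir.sum_weight_le_prodCount` (JS Cor. 3.5) for `HC`, the latter from the
  arithmetic of `MonotoneGapHamiltonianWeights.lean`;
* `JerrumSnir.le_prodCount_hcPoly` — **JS §4.4, the lower bound**: every monotone computation of
  `HC_{n×n}` over `ℝ≥0`, `n ≥ 3`, has at least `(n-1)! · w(n) = (n-1)[(n-2)2^{n-3} + 1]` product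
  gates ("`⊗`-complexity of `p ≥ (n-1)![2^{(n-3)}(n-2)+1]/(n-2)! = (n-1)[(n-2)2^{(n-3)} + 1]`").
  The matching upper bound and the assembly of the named fact are in
  `MonotoneGapHamiltonianUpper.lean` / `MonotoneGapHamiltonianProofs.lean`.
-/

noncomputable section

namespace Literature.Barriers.ValiantsHypothesis

namespace JerrumSnir

open Literature.Computability.AlgebraicComplexity MvPolynomial Finset Equiv

variable {n : ℕ}

/-! ### The monomials of the Hamiltonian circuit polynomial -/

/-- `HC = Σ_{π full cycle} X^{μ_π}`. [cite: JerrumSnir1982, §4.4 (p. 889)] -/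
theorem hcPoly_eq_sum_monomial (R : Type*) [CommSemiring R] :
    hcPoly (Fin n) R =
      ∑ π ∈ Finset.univ.filter (fun π : Perm (Fin n) => π.cycleType = {Fintype.card (Fin n)}),
        monomial (permMonomial π) (1 : R) := by
  unfold hcPoly Matrix.hamiltonianCycleSum
  refine Finset.sum_congr rfl fun π _ => ?_
  rw [permMonomial, monomial_sum_one]
  refine Finset.prod_congr rfl fun i _ => ?_
  simp [Matrix.mvPolynomialX_apply, X]

/-- The coefficients of `HC`. [folklore] -/
theorem coeff_hcPoly (R : Type*) [CommSemiring R] (d : Fin n × Fin n →₀ ℕ) :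
    coeff d (hcPoly (Fin n) R) =
      ∑ π ∈ Finset.univ.filter (fun π : Perm (Fin n) => π.cycleType = {Fintype.card (Fin n)}),
        if permMonomial π = d then (1 : R) else 0 := by
  rw [hcPoly_eq_sum_monomial, coeff_sum]
  simp only [coeff_monomial]

/-- **The monomial set of `HC`**: `m ∈ mon(HC_{n×n}) ↔ m = μ_π` for a cyclic permutation `π` of
all `n` nodes ("the monomials of `p` correspond to Hamiltonian circuits in `K_n`").
[cite: JerrumSnir1982, §4.4 (p. 889)] -/
theorem mem_support_hcPoly (R : Type*) [CommSemiring R] [Nontrivial R] {m : Fin n × Fin n →₀ ℕ} :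
    m ∈ (hcPoly (Fin n) R).support ↔
      ∃ π : Perm (Fin n), π.cycleType = {Fintype.card (Fin n)} ∧ permMonomial π = m := by
  rw [mem_support_iff, coeff_hcPoly]
  constructor
  · intro h
    by_contra hne
    push Not at hne
    apply h
    refine Finset.sum_eq_zero fun π hπ => if_neg ?_
    exact hne π (Finset.mem_filter.1 hπ).2
  · rintro ⟨π, hπ, rfl⟩
    rw [Finset.sum_eq_single π]
    · simp
    · intro ρ _ hρ
      simp [permMonomial_injective.ne hρ]
    · intro h
      exact absurd (Finset.mem_filter.2 ⟨Finset.mem_univ π, hπ⟩) h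

/-- The monomial set of `HC` as an image. [cite: JerrumSnir1982, §4.4 (p. 889)] -/
theorem support_hcPoly (R : Type*) [CommSemiring R] [Nontrivial R] :
    (hcPoly (Fin n) R).support =
      (Finset.univ.filter fun π : Perm (Fin n) => π.cycleType = {Fintype.card (Fin n)}).image
        permMonomial := by
  ext m
  simp only [mem_support_hcPoly R, Finset.mem_image, Finset.mem_filter, Finset.mem_univ, true_and]

/-- **`|mon(HC_{n×n})| = (n-1)!`** for `n ≥ 2` (the number of cyclic permutations of `n` objects).
[cite: JerrumSnir1982, §4.4 (p. 890, `(n-1)![…]/(n-2)!`)] -/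
theorem card_support_hcPoly (R : Type*) [CommSemiring R] [Nontrivial R] (hn : 2 ≤ n) :
    (hcPoly (Fin n) R).support.card = (n - 1).factorial := by
  rw [support_hcPoly R, Finset.card_image_of_injective _ permMonomial_injective]
  have h := Equiv.Perm.card_of_cycleType_singleton (α := Fin n) (n := n) hn (by rw [Fintype.card_fin])
  rw [Fintype.card_fin, Nat.choose_self, mul_one] at h
  rw [Fintype.card_fin]
  convert h using 2

/-- Monomials of `HC` are multilinear, of degree `n`, and nonzero for `n ≥ 1`. [cite: JerrumSnir1982, §4.4] -/
theorem support_hcPoly_shape (R : Type*) [CommSemiring R] [Nontrivial R] {m : Fin n × Fin n →₀ ℕ}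
    (hm : m ∈ (hcPoly (Fin n) R).support) :
    (∀ i, m i ≤ 1) ∧ m.degree = n ∧ (1 ≤ n → m ≠ 0) := by
  obtain ⟨π, -, rfl⟩ := (mem_support_hcPoly R).1 hm
  exact ⟨permMonomial_apply_le_one π, degree_permMonomial π, fun hn => permMonomial_ne_zero hn π⟩

/-! ### The partition argument (JS p. 889–890) -/

/-- **One block of JS's partition argument for `HC`.** If `a + e` is a monomial of `HC` for every
`a ∈ A` (i.e. `a + e = μ_π` for a full cycle `π = π_a`), and `a₀ ∈ A`, then `|A| ≤ (deg a₀ - 1)!`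
and `deg a₀ + deg e = n`: the columns not met by `e` are the same `d = deg a₀` columns `I_a` for
every `a ∈ A`, the cycles `π_a` all restrict to `e` off `I_a`, `a ↦ π_a` is injective, and full
cycles with a common restriction off `I_a` are at most `(d - 1)!` in number (`π ↦ π*`,
`card_le_factorial_of_agree`). [cite: JerrumSnir1982, §4.4 (p. 890)] -/
theorem card_le_factorial_pred_of_add_mem {A : Finset (Fin n × Fin n →₀ ℕ)}
    {e a₀ : Fin n × Fin n →₀ ℕ}
    (hA : ∀ a ∈ A, ∃ π : Perm (Fin n), π.cycleType = {Fintype.card (Fin n)} ∧ a + e = permMonomial π)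
    (ha₀ : a₀ ∈ A) : A.card ≤ (a₀.degree - 1).factorial ∧ a₀.degree + e.degree = n := by
  classical
  obtain ⟨π₀, -, hσ₀⟩ := hA a₀ ha₀
  -- the columns not met by `e`
  let p : Fin n → Prop := fun i => ∀ r, e (r, i) = 0
  set S : Finset (Fin n) := Finset.univ.filter p with hSdef
  have hcol : ∀ (x : Fin n × Fin n →₀ ℕ) (π : Perm (Fin n)), x + e = permMonomial π →
      ∀ i, colCount x i + colCount e i = 1 := by
    intro x π hx i
    rw [← colCount_add, hx]
    exact colCount_permMonomial π i
  have he_col : ∀ i, colCount e i = if p i then 0 else 1 := by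
    intro i
    have h := hcol a₀ π₀ hσ₀ i
    by_cases hp : p i
    · rw [if_pos hp]
      exact Finset.sum_eq_zero fun r _ => hp r
    · rw [if_neg hp]
      have hne : colCount e i ≠ 0 := by
        intro h0
        apply hp
        intro r
        exact (Finset.sum_eq_zero_iff.1 h0) r (Finset.mem_univ r)
      omega
  have hx_col : ∀ (x : Fin n × Fin n →₀ ℕ) (π : Perm (Fin n)), x + e = permMonomial π →
      ∀ i, colCount x i = if p i then 1 else 0 := by
    intro x π hx i
    have h := hcol x π hx i
    rw [he_col i] at h
    split_ifs at h ⊢ <;> omega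
  -- degrees
  have hdeg : ∀ (x : Fin n × Fin n →₀ ℕ) (π : Perm (Fin n)), x + e = permMonomial π →
      x.degree = S.card := by
    intro x π hx
    rw [degree_eq_sum_colCount]
    simp_rw [hx_col x π hx]
    rw [Finset.sum_boole]
    simp [hSdef]
  have hdeg_e : e.degree = (Finset.univ.filter fun i => ¬ p i).card := by
    rw [degree_eq_sum_colCount, Finset.card_eq_sum_ones, Finset.sum_filter]
    refine Finset.sum_congr rfl fun i _ => ?_
    rw [he_col i]
    by_cases hp : p i <;> simp [hp]
  have hsum : a₀.degree + e.degree = n := by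
    rw [hdeg a₀ π₀ hσ₀, hdeg_e, hSdef, Finset.card_filter_add_card_filter_not, Finset.card_univ,
      Fintype.card_fin]
  refine ⟨?_, hsum⟩
  -- every `π` with `x + e = permMonomial π` agrees with `π₀` off `S` (there it is `e`)
  have key : ∀ (x : Fin n × Fin n →₀ ℕ) (π : Perm (Fin n)), x + e = permMonomial π →
      ∀ i, i ∉ S → π i = π₀ i := by
    intro x π hπ i hi
    have hpi : ¬ p i := by simpa [hSdef] using hi
    simp only [p, not_forall] at hpi
    obtain ⟨r, hr⟩ := hpi
    have h1 : permMonomial π (r, i) ≠ 0 := by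
      rw [← hπ, Finsupp.add_apply]; omega
    have h2 : permMonomial π₀ (r, i) ≠ 0 := by
      rw [← hσ₀, Finsupp.add_apply]; omega
    rw [permMonomial_apply] at h1 h2
    simp only [ne_eq, ite_eq_right_iff, one_ne_zero, imp_false, not_not] at h1 h2
    rw [h1, h2]
  by_cases hS : S.Nonempty
  · choose! πf hπf using hA
    have hinj : Set.InjOn πf A := by
      intro a ha b hb hab
      have h3 : a + e = b + e := by rw [(hπf a ha).2, (hπf b hb).2, hab]
      exact add_right_cancel h3
    rw [← Finset.card_image_of_injOn hinj, hdeg a₀ π₀ hσ₀]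
    refine card_le_factorial_of_agree hS (A.image πf) ?_ ?_
    · intro π hπ
      obtain ⟨a, ha, rfl⟩ := Finset.mem_image.1 hπ
      exact (hπf a ha).1
    · intro π₁ h₁ π₂ h₂ x hx
      obtain ⟨a, ha, rfl⟩ := Finset.mem_image.1 h₁
      obtain ⟨b, hb, rfl⟩ := Finset.mem_image.1 h₂
      rw [key a (πf a) (hπf a ha).2 x hx, key b (πf b) (hπf b hb).2 x hx]
  · -- `S = ∅`: every element of `A` is the unit monomial
    have hS0 : S = ∅ := Finset.not_nonempty_iff_eq_empty.1 hS
    have hzero : ∀ a ∈ A, a = 0 := by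
      intro a ha
      obtain ⟨π, -, hπ⟩ := hA a ha
      have h3 := hdeg a π hπ
      rw [hS0, Finset.card_empty] at h3
      exact (Finsupp.degree_eq_zero_iff _).1 h3
    have hsub : A ⊆ {0} := fun a ha => Finset.mem_singleton.2 (hzero a ha)
    calc A.card ≤ ({0} : Finset (Fin n × Fin n →₀ ℕ)).card := Finset.card_le_card hsub
      _ = 1 := Finset.card_singleton _
      _ ≤ (a₀.degree - 1).factorial := Nat.succ_le_of_lt (Nat.factorial_pos _)

/-- **JS's content bound for `HC` (three-set form).** If `A + B + C ⊆ mon(HC_{n×n})` for monomial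
sets with `a ∈ A`, `b ∈ B`, `C ≠ ∅`, then
`|A| · |B| · |C| ≤ (deg a - 1)! (deg b - 1)! (n - deg (a + b) - 1)!` and `deg (a + b) ≤ n`
("`|mon(a)| ≤ (d-1)!`. Similarly, `|mon(b)| ≤ (r-d-1)!` and `|mon(c)| ≤ (n-r-1)!` (`r < n`), `1`
(`r = n`), the second case being the degenerate one when `I_c = ∅`" — here `(0 - 1)! = 0! = 1`).
[cite: JerrumSnir1982, §4.4 (p. 890)] -/
theorem card_mul_card_mul_card_le_hc (R : Type*) [CommSemiring R] [Nontrivial R]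
    {A B C : Finset (Fin n × Fin n →₀ ℕ)} {a b : Fin n × Fin n →₀ ℕ} (ha : a ∈ A) (hb : b ∈ B)
    (hC : C.Nonempty)
    (h : ∀ a' ∈ A, ∀ b' ∈ B, ∀ c' ∈ C, a' + b' + c' ∈ (hcPoly (Fin n) R).support) :
    A.card * B.card * C.card ≤
        (a.degree - 1).factorial * (b.degree - 1).factorial * (n - (a + b).degree - 1).factorial ∧
      (a + b).degree ≤ n := by
  obtain ⟨c, hc⟩ := hC
  have hA : ∀ a' ∈ A, ∃ π : Perm (Fin n), π.cycleType = {Fintype.card (Fin n)} ∧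
      a' + (b + c) = permMonomial π := by
    intro a' ha'
    obtain ⟨π, hπ, hσ⟩ := (mem_support_hcPoly R).1 (h a' ha' b hb c hc)
    exact ⟨π, hπ, by rw [← add_assoc, hσ]⟩
  have hB : ∀ b' ∈ B, ∃ π : Perm (Fin n), π.cycleType = {Fintype.card (Fin n)} ∧
      b' + (a + c) = permMonomial π := by
    intro b' hb'
    obtain ⟨π, hπ, hσ⟩ := (mem_support_hcPoly R).1 (h a ha b' hb' c hc)
    exact ⟨π, hπ, by rw [hσ]; abel⟩
  have hC' : ∀ c' ∈ C, ∃ π : Perm (Fin n), π.cycleType = {Fintype.card (Fin n)} ∧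
      c' + (a + b) = permMonomial π := by
    intro c' hc'
    obtain ⟨π, hπ, hσ⟩ := (mem_support_hcPoly R).1 (h a ha b hb c' hc')
    exact ⟨π, hπ, by rw [hσ]; abel⟩
  obtain ⟨hAcard, -⟩ := card_le_factorial_pred_of_add_mem hA ha
  obtain ⟨hBcard, -⟩ := card_le_factorial_pred_of_add_mem hB hb
  obtain ⟨hCcard, hCdeg⟩ := card_le_factorial_pred_of_add_mem hC' hc
  have hcdeg : c.degree = n - (a + b).degree := by omega
  refine ⟨?_, by omega⟩
  rw [← hcdeg]
  exact Nat.mul_le_mul (Nat.mul_le_mul hAcard hBcard) hCcard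

/-! ### The lower bound for `HC` (JS Cor. 3.5 + §4.4) -/

section LowerBound

open scoped NNReal

/-- **`HC` satisfies the content bound hypothesis with `c(r, d) = (d-1)! (r-d-1)! (n-r-1)!`
(`r < n`), `(d-1)! (n-d-1)!` (`r = n`).** [cite: JerrumSnir1982, §4.4 (p. 890)] -/
theorem contentBound_hcPoly (n : ℕ) : ContentBound (hcPoly (Fin n) ℝ≥0) (hcDelta n) := by
  intro A B C a ha b hb hC h
  obtain ⟨hle, hrn⟩ := card_mul_card_mul_card_le_hc ℝ≥0 ha hb hC h
  unfold hcDelta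
  have hsub : (a + b).degree - a.degree = b.degree := by
    rw [map_add]
    exact Nat.add_sub_cancel_left _ _
  rw [hsub]
  have heq : (a.degree - 1).factorial * (b.degree - 1).factorial * (n - (a + b).degree - 1).factorial =
      (a.degree - 1).factorial * (b.degree - 1).factorial *
        (if (a + b).degree < n then (n - (a + b).degree - 1).factorial else 1) := by
    split_ifs with hlt
    · rfl
    · rw [show n - (a + b).degree - 1 = 0 by omega, Nat.factorial_zero]
  rw [heq] at hle
  exact_mod_cast hle

/-- **The `HC` content bound and weight satisfy the weight recurrence hypothesis up to degree
`n`** (JS (3.3)–(3.5), Lemma 3.6, §4.4). [cite: JerrumSnir1982, Thm. 3.4, Lemma 3.6 and §4.4] -/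
theorem weightBound_hc (n : ℕ) : WeightBound n (hcDelta n) (hcWeight n) where
  zero := (hcWeight_zero n).le
  one := (hcWeight_one n).le
  pos := fun r d _ _ _ => hcDelta_pos n r d
  recur := fun _ _ hd hdr hrn => hcWeight_rec hd hdr hrn

/-- The total weight of the monomials of `HC` is `(n-1)! · w(n)` (`n ≥ 2`).
[cite: JerrumSnir1982, Cor. 3.5 and §4.4 (p. 890)] -/
theorem sum_hcWeight_support_hcPoly (hn : 2 ≤ n) :
    ∑ m ∈ (hcPoly (Fin n) ℝ≥0).support, hcWeight n m.degree =
      ((n - 1).factorial : ℝ) * hcWeight n n := by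
  have h : ∀ m ∈ (hcPoly (Fin n) ℝ≥0).support, hcWeight n m.degree = hcWeight n n := by
    intro m hm
    rw [(support_hcPoly_shape ℝ≥0 hm).2.1]
  rw [Finset.sum_congr rfl h, Finset.sum_const, card_support_hcPoly ℝ≥0 hn, nsmul_eq_mul]

/-- **Jerrum–Snir 1982, §4.4 — the lower bound: the monotone `⊗`-complexity of the `n × n`
Hamiltonian circuit polynomial is at least `(n-1)[(n-2)2^{n-3} + 1]`.** Every monotone
computation (plain fan-in-two circuit over `ℝ≥0`, `IsMonotoneComputation`) of `hcPoly (Fin n) ℝ≥0`,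
`n ≥ 3`, has at least `(n-1)((n-2)2^{n-3} + 1)` product gates: by Cor. 3.5 with the content bound
`c(r,d)` and `w(n) = (2^{n-3}(n-2) + 1)/(n-2)!`, "`⊗`-complexity of
`p ≥ (n-1)![2^{(n-3)}(n-2) + 1]/(n-2)! = (n-1)[(n-2)2^{(n-3)} + 1]`".
[cite: JerrumSnir1982, §4.4 (pp. 889–890) and Cor. 3.5] -/
theorem le_prodCount_hcPoly {n : ℕ} (hn : 3 ≤ n) {P : ArithCircuit ℝ≥0 (Fin n × Fin n)}
    (hP : IsMonotoneComputation P (hcPoly (Fin n) ℝ≥0)) :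
    (n - 1) * ((n - 2) * 2 ^ (n - 3) + 1) ≤ prodCount P := by
  have hp0 : ∀ m ∈ (hcPoly (Fin n) ℝ≥0).support, m ≠ 0 := fun m hm =>
    (support_hcPoly_shape ℝ≥0 hm).2.2 (by omega)
  have hlin : ∀ m ∈ (hcPoly (Fin n) ℝ≥0).support, ∀ i, m i ≤ 1 := fun m hm =>
    (support_hcPoly_shape ℝ≥0 hm).1
  have hN : ∀ m ∈ (hcPoly (Fin n) ℝ≥0).support, m.degree ≤ n := fun m hm =>
    (support_hcPoly_shape ℝ≥0 hm).2.1.le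
  have h := sum_weight_le_prodCount hP hp0 hlin hN (contentBound_hcPoly n) (weightBound_hc n)
  rw [sum_hcWeight_support_hcPoly (by omega), factorial_mul_hcWeight_eq_natCast hn] at h
  exact_mod_cast h

end LowerBound

end JerrumSnir

end Literature.Barriers.ValiantsHypothesis
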